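import Summits.HodgeConjecture.HodgeConjecture.Theorems.LinearSystemTorelliLocalTubeSpanSp2Elementary
import Summits.HodgeConjecture.HodgeConjecture.Theorems.LinearSystemTorelliLocalTubeSpanCompanion
import Summits.HodgeConjecture.HodgeConjecture.Theorems.LinearSystemTorelliLocalTubeSpanStarBasisOfCompanions
import Summits.HodgeConjecture.HodgeConjecture.Theorems.LinearSystemTorelliLocalTubeSpanLemma11OfStarBasis
import Summits.HodgeConjecture.HodgeConjecture.Theorems.LinearSystemTorelliLocalTubeSpanUnimodularTransitivity
import Summits.HodgeConjecture.HodgeConjecture.Theorems.LinearSystemTorelliLocalTubeSpanCapstoneOrbitJanssen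

/-!
# Route LinearSystemTorelli — crux `LocalTubeSpan` (stmt-HodgeConjecture-2490): ONE NAMED FACT — Janssen's Theorem 2.9 and Schnell's Lemma 11 from Janssen's Theorem 2.5

Helper file (`--supports stmt-HodgeConjecture-2490`, line `Sketch` of the crux chain, cycle 7,
continuation lead c6; the compositions of the cycle).

After cycle 6 the arithmetic input of every conditional theorem of the line was exactly Janssen's
two primary theorems, the named facts `Janssen1983_thm2_5` (= [Schnell2010] §7 Thm. 10: the
monodromy group `Γ_Δ` of a skew vanishing lattice contains the level-2 congruence subgroup
`Sp♯₂(ℤΔ)`) and `Janssen1983_thm2_9` (`x ∈ Δ ↔ x` unimodular `∧ x ≡ δ (mod 2ℤΔ)`) of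
`Literature/AlgebraicGeometry/HodgeTheory/SkewVanishingLattice`.  This file removes the second:

* `localTubeSpan_companion_of_thm2_5` — granting Theorem 2.5 only: `δ ∈ Δ`, `⟨δ, y⟩ = 1`
  (`y ∈ ℤΔ`), `z ∈ ℤΔ` with `⟨z, y⟩ = 0` ⟹ `δ + 2z ∈ Δ` (the two elementary families of `Sp♯₂`,
  `…Sp2Elementary`, and `…Companion`); in particular the radical companions
  `localTubeSpan_add_two_smul_mem_of_thm2_5` (the shape of `IsSkewVanishingLattice.add_two_smul_mem`).
* `localTubeSpan_schnell2010_lemma11_of_thm2_5 : Janssen1983_thm2_5 → Schnell2010_lemma11`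
  (star bases from companions, `…StarBasisOfCompanions`; Lemma 11 nondegenerate from star bases,
  `…Lemma11OfStarBasis`; the general case by cycle 6's frame lift, `…Lemma11OfNondegenerate`).
* `localTubeSpan_janssen_thm2_9_of_thm2_5 : Janssen1983_thm2_5 → Janssen1983_thm2_9` — THEOREM 2.9
  IS A COROLLARY OF THEOREM 2.5: `⇒` by a partner from the unimodular pair and transitivity; `⇐` by
  the unimodular transitivity of the level-2 elementary moves (`…UnimodularTransitivity`) from `δ`
  to `x = δ + 2z`, then `Γ_Δ`-stability of `Δ`.
* Consequently the cycle-6 capstone granting Theorem 2.5 ONLY,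
  `localTubeSpan_cfree_at_of_completeOrbitBasis_of_thm2_5` (and likewise every consumer of
  `Schnell2010_lemma11` / `Janssen1983_thm2_9` in the line, by the two theorems above).

So the whole line now rests on ONE named fact, Janssen's Theorem 2.5 — the one theorem
[Schnell2010] itself cites (as Thm. 10).  Named fact used: `Janssen1983_thm2_5` (hypothesis `h25`);
no `sorry`.
-/

-- `Summit.HodgeConjecture.HodgeConjecture.Theorems` is the mandated namespace (single-conjunct summit:
-- Sub = Summit), which `linter.dupNamespace` flags on every declaration; the lakefile turns the
-- linter off tree-wide (weak option), restated here so stand-alone elaboration is warning-free too.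
set_option linter.dupNamespace false

noncomputable section

open CategoryTheory groupCohomology
open _root_.Topology Filter
open Literature.AlgebraicGeometry Literature.AlgebraicGeometry.HodgeTheory
open Literature.AlgebraicTopology.SingularHomology

namespace Summit.HodgeConjecture.HodgeConjecture.Theorems

universe u v

section Lattice

variable {V : Type} [AddCommGroup V] [Module ℚ V]

/-- A skew vanishing lattice spans a finite-dimensional space (`ℤΔ` is finitely generated and `Δ`
spans `V`). [folklore] -/
theorem localTubeSpan_finiteDimensional_of_isSkewVanishingLattice (B : LinearMap.BilinForm ℚ V)
    (Δ : Set V) (hΔ : IsSkewVanishingLattice B Δ) : FiniteDimensional ℚ V := by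
  obtain ⟨S, hS⟩ := hΔ.fg
  refine Module.finite_def.2 ⟨S, ?_⟩
  have h1 : Submodule.span ℚ (S : Set V) =
      Submodule.span ℚ (Submodule.span ℤ (S : Set V) : Set V) :=
    (Submodule.span_span_of_tower ℤ ℚ (S : Set V)).symm
  rw [h1, hS, Submodule.span_span_of_tower, hΔ.span_eq_top]

/-- **Companions from Janssen's Theorem 2.5 alone.**  For a skew vanishing lattice `Δ` (alternating
`B`), `δ ∈ Δ` with a partner `y ∈ ℤΔ`, `⟨δ, y⟩ = 1`, and `z ∈ ℤΔ` orthogonal to `y`, the companion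
`δ + 2z` lies in `Δ`: the squared transvection pair `E_{y,w}²` and the squares `T_y^{±2}` that move
`δ` to `δ + 2z` (`z = βy + w`) lie in the level-2 congruence subgroup, hence in `Γ_Δ` by Theorem 2.5.
[cite: Janssen1983, Thm. 2.5] -/
theorem localTubeSpan_companion_of_thm2_5 (h25 : Janssen1983_thm2_5)
    (B : LinearMap.BilinForm ℚ V) (hB : B.IsAlt) (Δ : Set V) (hΔ : IsSkewVanishingLattice B Δ)
    {δ y z : V} (hδ : δ ∈ Δ) (hy : y ∈ Submodule.span ℤ Δ) (hδy : B δ y = 1)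
    (hz : z ∈ Submodule.span ℤ Δ) (hzy : B z y = 0) : δ + (2 : ℚ) • z ∈ Δ := by
  haveI := localTubeSpan_finiteDimensional_of_isSkewVanishingLattice B Δ hΔ
  obtain ⟨hpair, hsq⟩ := localTubeSpan_sp2Elementary h25 B hB Δ hΔ
  exact localTubeSpan_companion B hB Δ hΔ hpair hsq hδ hy hδy hz hzy

/-- **Radical companions from Theorem 2.5** (the shape of `IsSkewVanishingLattice.add_two_smul_mem`,
which took Theorem 2.9): for `δ ∈ Δ` and `β ∈ ℤΔ` orthogonal to `Δ`, `δ + 2β ∈ Δ` — a partner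
`y = gδ₂ ∈ Δ` of `δ = gδ₁` comes from the unimodular pair `⟨δ₁, δ₂⟩ = 1` and transitivity, and
`⟨β, y⟩ = 0`. [cite: Janssen1983, Thm. 2.5 and Thm. 2.9] -/
theorem localTubeSpan_add_two_smul_mem_of_thm2_5 (h25 : Janssen1983_thm2_5)
    {B : LinearMap.BilinForm ℚ V} (hB : B.IsAlt) {Δ : Set V} (hΔ : IsSkewVanishingLattice B Δ)
    {δ β : V} (hδ : δ ∈ Δ) (hβ : β ∈ Submodule.span ℤ Δ) (hβrad : ∀ x ∈ Δ, B β x = 0) :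
    δ + 2 • β ∈ Δ := by
  obtain ⟨δ₁, hδ₁, δ₂, hδ₂, h12⟩ := hΔ.exists_pair
  obtain ⟨g, hg, hgδ⟩ := hΔ.transitive δ₁ hδ₁ δ hδ
  have hy : ((g : (V →ₗ[ℚ] V)ˣ) : V →ₗ[ℚ] V) δ₂ ∈ Δ := hΔ.stable g hg δ₂ hδ₂
  have hδy : B δ (((g : (V →ₗ[ℚ] V)ˣ) : V →ₗ[ℚ] V) δ₂) = 1 := by
    rw [← hgδ, localTubeSpan_transvectionGroup_isometry B hB Δ hg, h12]
  rw [two_nsmul, ← two_smul ℚ]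
  exact localTubeSpan_companion_of_thm2_5 h25 B hB Δ hΔ hδ (Submodule.subset_span hy) hδy hβ
    (hβrad _ hy)

/-- **Schnell's Lemma 11 (nondegenerate lattices) from Janssen's Theorem 2.5 alone**: star bases
exist by `localTubeSpan_exists_starBasis_of_companions` on the companions of
`localTubeSpan_companion_of_thm2_5`, and `localTubeSpan_schnell2010_lemma11_nondegenerate_of_starBasis`
concludes. [cite: Schnell2010, §7 Lemma 11 and Thm. 10] -/
theorem localTubeSpan_schnell2010_lemma11_nondegenerate_of_thm2_5 (h25 : Janssen1983_thm2_5) :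
    Schnell2010_lemma11_nondegenerate :=
  localTubeSpan_schnell2010_lemma11_nondegenerate_of_starBasis h25 fun _ _ _ _ Bq hBq Δq hΔq =>
    localTubeSpan_exists_starBasis_of_companions Bq hBq Δq hΔq
      fun _ hδ _ hy hδy _ hz hzy => localTubeSpan_companion_of_thm2_5 h25 Bq hBq Δq hΔq hδ hy hδy hz hzy

/-- **Schnell's Lemma 11 (all alternating forms) from Janssen's Theorem 2.5 alone** (the
nondegenerate case lifted through the radical by cycle 6's
`localTubeSpan_schnell2010_lemma11_of_nondegenerate`).  So every theorem of the line that grants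
`Schnell2010_lemma11` holds granting `Janssen1983_thm2_5` only. [cite: Schnell2010, §7 Lemma 11 and Thm. 10] -/
theorem localTubeSpan_schnell2010_lemma11_of_thm2_5 (h25 : Janssen1983_thm2_5) :
    Schnell2010_lemma11 :=
  localTubeSpan_schnell2010_lemma11_of_nondegenerate fun W _ _ _ Bq hBq hnd Δq hΔq =>
    localTubeSpan_schnell2010_lemma11_nondegenerate_of_thm2_5 h25 W Bq hBq hnd Δq hΔq

/-- **Janssen's Theorem 2.9 is a corollary of Theorem 2.5.**  For a skew vanishing lattice `Δ`
(alternating `B`, possibly degenerate) and `x ∈ ℤΔ`: `x ∈ Δ` iff `⟨x, y⟩ = 1` for some `y ∈ ℤΔ` and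
`x ≡ δ (mod 2ℤΔ)` for some `δ ∈ Δ`.  `⇒`: a partner `gδ₂` of `x = gδ₁` from the pair
`⟨δ₁, δ₂⟩ = 1`, and `δ = x`, `z = 0`.  `⇐`: `δ` has a partner `gδ₂ ∈ ℤΔ`; the squares `T_a²`
(`a ∈ ℤΔ`) and the squared transvection pairs `E_{e,f}²` (`⟨e,f⟩ = 0`) lie in `Γ_Δ` by Theorem 2.5
(`localTubeSpan_sp2Elementary`) and act transitively on the unimodular vectors of `δ + 2ℤΔ`
(`localTubeSpan_unimodularTransitivity`), so `x = g'δ ∈ Δ` by stability.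
[cite: Janssen1983, Thm. 2.9 (from Thm. 2.5)] -/
theorem localTubeSpan_janssen_thm2_9_of_thm2_5 (h25 : Janssen1983_thm2_5) : Janssen1983_thm2_9 := by
  intro W _ _ B hB Δ hΔ x hx
  haveI : FiniteDimensional ℚ W := localTubeSpan_finiteDimensional_of_isSkewVanishingLattice B Δ hΔ
  constructor
  · intro hxΔ
    obtain ⟨δ₁, hδ₁, δ₂, hδ₂, h12⟩ := hΔ.exists_pair
    obtain ⟨g, hg, hgx⟩ := hΔ.transitive δ₁ hδ₁ x hxΔ
    refine ⟨⟨((g : (W →ₗ[ℚ] W)ˣ) : W →ₗ[ℚ] W) δ₂,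
      localTubeSpan_transvectionGroup_map_span_int B hB Δ hΔ.integral hg (Submodule.subset_span hδ₂),
      ?_⟩, x, hxΔ, 0, Submodule.zero_mem _, by rw [sub_self, smul_zero]⟩
    rw [← hgx, localTubeSpan_transvectionGroup_isometry B hB Δ hg, h12]
  · rintro ⟨⟨y', hy', hxy'⟩, δ, hδ, z, hz, hxδ⟩
    obtain ⟨hpair, hsq⟩ := localTubeSpan_sp2Elementary h25 B hB Δ hΔ
    -- a partner of `δ` inside `ℤΔ`
    obtain ⟨δ₁, hδ₁, δ₂, hδ₂, h12⟩ := hΔ.exists_pair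
    obtain ⟨g, hg, hgδ⟩ := hΔ.transitive δ₁ hδ₁ δ hδ
    have hy : ((g : (W →ₗ[ℚ] W)ˣ) : W →ₗ[ℚ] W) δ₂ ∈ Submodule.span ℤ Δ :=
      localTubeSpan_transvectionGroup_map_span_int B hB Δ hΔ.integral hg (Submodule.subset_span hδ₂)
    have hδy : B δ (((g : (W →ₗ[ℚ] W)ˣ) : W →ₗ[ℚ] W) δ₂) = 1 := by
      rw [← hgδ, localTubeSpan_transvectionGroup_isometry B hB Δ hg, h12]
    have ht : ∃ z ∈ Submodule.span ℤ Δ, x = δ + (2 : ℚ) • z :=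
      ⟨z, hz, by rw [two_smul, ← two_nsmul, ← hxδ, add_sub_cancel]⟩
    obtain ⟨g', hg', hg'δ⟩ := localTubeSpan_unimodularTransitivity B hB Δ hΔ.integral
      (transvectionGroup B Δ) hpair hsq (Submodule.subset_span hδ) hy hδy ht ⟨y', hy', hxy'⟩
    rw [← hg'δ]
    exact hΔ.stable g' hg' δ hδ

/-- The line's arithmetic input after cycle 7: Schnell's Lemma 11 AND Janssen's Theorem 2.9, both
from Theorem 2.5. [cite: Janssen1983, Thm. 2.5] -/
theorem localTubeSpan_lemma11_and_thm2_9_of_thm2_5 (h25 : Janssen1983_thm2_5) :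
    Schnell2010_lemma11 ∧ Janssen1983_thm2_9 :=
  ⟨localTubeSpan_schnell2010_lemma11_of_thm2_5 h25, localTubeSpan_janssen_thm2_9_of_thm2_5 h25⟩

/-- **A skew vanishing lattice is determined by its lattice, its form and its mod-2 shadow**
(granting Janssen's Theorem 2.5): two skew vanishing lattices `Δ, Δ'` for the same alternating form
with `ℤΔ = ℤΔ'` whose images in `ℤΔ/2ℤΔ` agree (`Δ ⊆ Δ' + 2ℤΔ` and `Δ' ⊆ Δ + 2ℤΔ`) coincide — by
Theorem 2.9 (a corollary of 2.5) membership is decided by unimodularity in the common lattice and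
the class mod `2ℤΔ`. [cite: Janssen1983, Thm. 2.9] -/
theorem localTubeSpan_eq_of_span_eq_of_shadow_eq (h25 : Janssen1983_thm2_5)
    (B : LinearMap.BilinForm ℚ V) (hB : B.IsAlt) (Δ Δ' : Set V) (hΔ : IsSkewVanishingLattice B Δ)
    (hΔ' : IsSkewVanishingLattice B Δ') (hspan : Submodule.span ℤ Δ = Submodule.span ℤ Δ')
    (h₁ : ∀ δ ∈ Δ, ∃ δ' ∈ Δ', ∃ z ∈ Submodule.span ℤ Δ, δ - δ' = 2 • z)
    (h₂ : ∀ δ' ∈ Δ', ∃ δ ∈ Δ, ∃ z ∈ Submodule.span ℤ Δ, δ' - δ = 2 • z) : Δ = Δ' := by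
  have h29 := localTubeSpan_janssen_thm2_9_of_thm2_5 h25
  ext x
  constructor
  · intro hx
    have hxΛ : x ∈ Submodule.span ℤ Δ := Submodule.subset_span hx
    obtain ⟨⟨y, hy, hxy⟩, -⟩ := (h29 V B hB Δ hΔ x hxΛ).1 hx
    obtain ⟨δ', hδ', z, hz, hxδ'⟩ := h₁ x hx
    rw [hspan] at hxΛ hy hz
    exact (h29 V B hB Δ' hΔ' x hxΛ).2 ⟨⟨y, hy, hxy⟩, δ', hδ', z, hz, hxδ'⟩
  · intro hx
    have hxΛ : x ∈ Submodule.span ℤ Δ' := Submodule.subset_span hx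
    obtain ⟨⟨y, hy, hxy⟩, -⟩ := (h29 V B hB Δ' hΔ' x hxΛ).1 hx
    obtain ⟨δ, hδ, z, hz, hxδ⟩ := h₂ x hx
    rw [← hspan] at hxΛ hy
    exact (h29 V B hB Δ hΔ x hxΛ).2 ⟨⟨y, hy, hxy⟩, δ, hδ, z, hz, hxδ⟩

end Lattice

/-! ### The capstones, granting Theorem 2.5 only -/

section Capstones

variable {𝒳 Sb : Motives.SchemeOver ℂ} {π : 𝒳 ⟶ Sb} {n : ℕ} {T : Type v} [TopologicalSpace T]

/-- **The one-complete-orbit member along a neighbourhood basis, granting Janssen's Theorem 2.5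
ONLY** — cycle 6's `localTubeSpan_cfree_at_of_completeOrbitBasis_of_janssen` with its hypothesis
`Janssen1983_thm2_9` discharged by `localTubeSpan_janssen_thm2_9_of_thm2_5`: along a basis of `𝓝 t₀`
whose basic sets have path-connected punctured preimage and one local subgroup presented by a
complete orbit, every class undetected near `t₀` lies in `localKernel ι (D.V k) s t₀`.
[cite: Schnell2010, §7 Prop. 12, Lemma 11 and Thm. 10] -/
theorem localTubeSpan_cfree_at_of_completeOrbitBasis_of_thm2_5 (h25 : Janssen1983_thm2_5)
    (ι : C(smoothFiberLocus π n, T)) (D : DirectImageLocalSystem π n) (k : ℕ)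
    (s : smoothFiberLocus π n) {ι' : Sort*} {p : ι' → Prop} {bs : ι' → Set T} {t₀ : T}
    (hbs : (𝓝 t₀).HasBasis p bs)
    (horb : ∀ i, p i → IsPathConnected (ι ⁻¹' bs i) ∧
      ∃ (s' : smoothFiberLocus π n) (hs' : ι s' ∈ bs i) (γ : Path s' s)
        (B : LinearMap.BilinForm ℚ (Motives.bettiCohomology (Motives.fiberOver π s.1) k))
        (Δ : Set (Motives.bettiCohomology (Motives.fiberOver π s.1) k))
        (gen : Set (localSubgroup ι s (bs i) hs' γ)),
        B.IsAlt ∧ Subgroup.closure gen = ⊤ ∧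
        (∀ t ∈ gen, ∃ δ ∈ Δ, ∀ x,
          D.ratMonodromy k s (t : FundamentalGroup (smoothFiberLocus π n) s) x = x - B x δ • δ) ∧
        (∀ δ ∈ Δ, ∃ g : localSubgroup ι s (bs i) hs' γ, ∀ x,
          D.ratMonodromy k s (g : FundamentalGroup (smoothFiberLocus π n) s) x = x - B x δ • δ) ∧
        (Submodule.span ℤ Δ).FG ∧ (∀ δ ∈ Δ, ∀ δ' ∈ Δ, ∃ z : ℤ, B δ δ' = z) ∧
        (∀ (g : localSubgroup ι s (bs i) hs' γ), ∀ δ ∈ Δ,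
          D.ratMonodromy k s (g : FundamentalGroup (smoothFiberLocus π n) s) δ ∈ Δ) ∧
        (∀ δ ∈ Δ, ∀ δ' ∈ Δ, ∃ g : localSubgroup ι s (bs i) hs' γ,
          D.ratMonodromy k s (g : FundamentalGroup (smoothFiberLocus π n) s) δ = δ') ∧
        (∃ δ₁ ∈ Δ, ∃ δ₂ ∈ Δ, B δ₁ δ₂ = 1))
    (ξ : groupCohomology.H1 (monodromyRepObj (D.V k) s))
    (hξ : ∃ N ∈ 𝓝 t₀, ∀ (s' : smoothFiberLocus π n) (hs' : ι s' ∈ N) (γ : Path s' s),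
      evalCoinvOn (monodromyRepObj (D.V k) s) (localSubgroup ι s N hs' γ) ξ = 0) :
    ξ ∈ localKernel ι (D.V k) s t₀ :=
  localTubeSpan_cfree_at_of_completeOrbitBasis_of_janssen h25
    (localTubeSpan_janssen_thm2_9_of_thm2_5 h25) ι D k s hbs horb ξ hξ

end Capstones

end Summit.HodgeConjecture.HodgeConjecture.Theorems

end
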